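import Summits.BirchSwinnertonDyer.BirchSwinnertonDyer.Theorems.EisensteinPrimesTwistDeformationShapiroEval
import Literature.NumberTheory.IwasawaTheory.Greenberg2006.CoinducedModuleDual
import HarnessLib

/-!
# Route `EisensteinPrimes` (rung K5), crux 2 `GoodLatticeBDPValue`, line `halves` v7, stub
# `stub_shapiroBridgePure` (K-Sh), brick E5b: EVERY CLASS OF `H¹(K_Σ/K, 𝐃)` IS KILLED BY A POWER OF
# `T₁ = X` AND OF `T₂ = C X` (helper for stmt-BirchSwinnertonDyer-19032)

Cell `bsd-eis`, seat `bsd-eis-k5-c2` (gen 9); HOME/k5-c2-MEMO-9.md ADDENDUM 2. This is the hypothesis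
`hnil` of the extension engine `…IwasawaTwoVarBalanceExtension.balanced_of_generators` (p536034): with it,
the `Λ₂ = ℤ_p⟦T₁,T₂⟧`-balance `⟨r • x, e c⟩ = ⟨x, e (r • c)⟩` of the bridge `e = shapiroEval` follows
from the three generator identities (`…ShapiroEval.shapiroEval_X_smul / _C_X_smul / _C_C_smul`,
p533162). Content:

* §1 `exists_uniform_pow_smul_eq_zero` — pointwise nilpotence on a finite set is uniform;
* §2 `IndModule₂.exists_X_pow_smul_eq_zero`, `IndModule₂.exists_C_X_pow_smul_eq_zero` — the discrete
  `Λ₂`-module `𝐃 = IndModule₂ 𝒪 p A` (smooth `p`-primary functions on `ℤ_p²`, `Tᵢ ↦ γᵢ − 1`) is locally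
  nilpotent for BOTH variables: the outer one is the tree's `BigRepModule.shiftSubOne_locNil` over
  `𝒪' = 𝒪⟦T⟧`; the inner one acts through the constants `C`, value-wise on the finitely many values
  `Φ(r)`, `r < p^{level}` (`BigRepModule.exists_level`, `PadicInt.appr`);
* §3 `exists_pow_smul_contOneCocycles_eq_zero`, **`exists_pow_smul_H1_eq_zero`**,
  `exists_pow_smul_selmer_eq_zero` — a continuous crossed homomorphism `G_{K,S} → 𝐃` has finitely
  many values (compact source, discrete target), so ONE exponent kills it, its class, and every
  element of every Selmer group `L.selmer ≤ H¹(K_Σ/K, 𝐃)` (as elements of the `Λ₂`-submodule).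

Theorems only; no definition, no named fact, no instance, no `sorry`. HONEST FRAMING: closes nothing
by itself (`--supports`). References: [Greenberg2006] p. 342 ("discrete Λ-module"), [GreenbergLNM1716]
§1 (after Conj. 1.3: Λ acts continuously on a discrete module ⇒ locally nilpotent),
[SerreGaloisCohomology1997] Ch. I §2.2.
-/

set_option autoImplicit false
set_option linter.dupNamespace false

noncomputable section

open scoped Classical
open NumberField IsDedekindDomain Field PowerSeries
open Literature.NumberTheory.EllipticCurves Literature.NumberTheory.GaloisRepresentations
  Literature.NumberTheory.IwasawaTheory.Greenberg2006 Literature.NumberTheory.IwasawaTheory.Greenberg2016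

namespace Summit.BirchSwinnertonDyer.BirchSwinnertonDyer.Theorems.GreenbergFullAtSelmer

/-! ## §1. Uniform nilpotence over a finite set -/

section Uniform

variable {R : Type*} [Monoid R] {N : Type*} [AddMonoid N] [DistribMulAction R N]

/-- If `r ^ n • m = 0` then `r ^ n' • m = 0` for every `n' ≥ n`. [folklore] -/
theorem pow_smul_eq_zero_of_le (r : R) {m : N} {n n' : ℕ} (h : r ^ n • m = 0) (hle : n ≤ n') :
    r ^ n' • m = 0 := by
  obtain ⟨k, rfl⟩ := Nat.exists_eq_add_of_le hle
  rw [add_comm, pow_add, mul_smul, h, smul_zero]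

/-- Pointwise nilpotence of `r` on a FINITE set of elements is uniform. [folklore] -/
theorem exists_uniform_pow_smul_eq_zero (r : R) {s : Set N} (hs : s.Finite)
    (h : ∀ m ∈ s, ∃ n : ℕ, r ^ n • m = 0) : ∃ n : ℕ, ∀ m ∈ s, r ^ n • m = 0 := by
  let f : N → ℕ := fun m ↦ if hm : m ∈ s then Classical.choose (h m hm) else 0
  refine ⟨hs.toFinset.sup f, fun m hm ↦ ?_⟩
  have hf : r ^ f m • m = 0 := by
    simp only [f, dif_pos hm]
    exact Classical.choose_spec (h m hm)
  exact pow_smul_eq_zero_of_le r hf (Finset.le_sup (f := f) (hs.mem_toFinset.mpr hm))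

end Uniform

/-! ## §2. `𝐃 = IndModule₂ 𝒪 p A` is locally nilpotent for `T₁ = X` and for `T₂ = C X` -/

section IndModule

variable {p : ℕ} [Fact p.Prime] {𝒪 : Type} [CommRing 𝒪] {A : Type} [AddCommGroup A] [Module 𝒪 A]

/-- Every `Φ ∈ 𝐃` is killed by a power of the OUTER variable `T₁ = X` (`γ₁ − 1` is locally nilpotent
on the smooth functions: the tree's `BigRepModule.shiftSubOne_locNil` over `𝒪' = 𝒪⟦T⟧`).
[cite: GreenbergLNM1716, §1 (discrete Λ-modules, after Conj. 1.3)] -/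
theorem IndModule₂.exists_X_pow_smul_eq_zero (Φ : IndModule₂ 𝒪 p A) :
    ∃ n : ℕ, (PowerSeries.X : PowerSeries (PowerSeries 𝒪)) ^ n • Φ = 0 := by
  obtain ⟨n, hn⟩ := BigRepModule.shiftSubOne_locNil (𝒪 := PowerSeries 𝒪) (p := p)
    (A := BigRepModule 𝒪 p A) Φ
  exact ⟨n, by rw [← BigRepModule.shiftSubOne_pow_eq_X_pow_smul, hn]⟩

omit [Fact p.Prime] in
/-- A smooth function of level `k` takes at `x` its value at the truncation `x.appr k < p^k`. [folklore] -/
theorem BigRepModule.apply_eq_apply_appr {B : Type} [AddCommGroup B] [Module 𝒪 B] [Fact p.Prime]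
    (Φ : BigRepModule 𝒪 p B) {k : ℕ} (hk : IsSmoothOfLevel p B k Φ) (x : ℤ_[p]) :
    Φ x = Φ ((x.appr k : ℕ) : ℤ_[p]) :=
  hk x _ (PadicInt.appr_spec k x)

/-- Every `Φ ∈ 𝐃` is killed by a power of the INNER variable `T₂ = C X`: `C X` acts value-wise
(`(C f • Φ)(x) = f • Φ(x)`, `BigRepModule.C_smul`), `Φ` has the finitely many values `Φ(r)`, `r < p^k`
(`k` = its level), and each value is killed by a power of `X` (`shiftSubOne_locNil` over `𝒪`).
[cite: GreenbergLNM1716, §1 (discrete Λ-modules, after Conj. 1.3)] -/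
theorem IndModule₂.exists_C_X_pow_smul_eq_zero (Φ : IndModule₂ 𝒪 p A) :
    ∃ n : ℕ, (PowerSeries.C PowerSeries.X : PowerSeries (PowerSeries 𝒪)) ^ n • Φ = 0 := by
  obtain ⟨k, hk⟩ := BigRepModule.exists_level Φ
  obtain ⟨n, hn⟩ := exists_uniform_pow_smul_eq_zero (PowerSeries.X : PowerSeries 𝒪)
    (Set.finite_range fun r : Fin (p ^ k) ↦ Φ ((r : ℕ) : ℤ_[p]))
    (fun Ψ _ ↦ by
      obtain ⟨m, hm⟩ := BigRepModule.shiftSubOne_locNil (𝒪 := 𝒪) (p := p) (A := A) Ψ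
      exact ⟨m, by rw [← BigRepModule.shiftSubOne_pow_eq_X_pow_smul, hm]⟩)
  refine ⟨n, ?_⟩
  rw [← map_pow, BigRepModule.C_smul]
  refine BigRepModule.ext fun x ↦ ?_
  rw [BigRepModule.smul_apply, BigRepModule.zero_apply, BigRepModule.apply_eq_apply_appr Φ hk x]
  exact hn _ ⟨⟨x.appr k, PadicInt.appr_lt x k⟩, rfl⟩

/-- Both variables at once, with ONE exponent. [cite: GreenbergLNM1716, §1 (discrete Λ-modules, after Conj. 1.3)] -/
theorem IndModule₂.exists_pow_smul_eq_zero (Φ : IndModule₂ 𝒪 p A) :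
    ∃ n : ℕ, (PowerSeries.X : PowerSeries (PowerSeries 𝒪)) ^ n • Φ = 0 ∧
      (PowerSeries.C PowerSeries.X : PowerSeries (PowerSeries 𝒪)) ^ n • Φ = 0 := by
  obtain ⟨n₁, h₁⟩ := IndModule₂.exists_X_pow_smul_eq_zero Φ
  obtain ⟨n₂, h₂⟩ := IndModule₂.exists_C_X_pow_smul_eq_zero Φ
  exact ⟨n₁ + n₂, pow_smul_eq_zero_of_le _ h₁ (Nat.le_add_right _ _),
    pow_smul_eq_zero_of_le _ h₂ (Nat.le_add_left _ _)⟩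

end IndModule

/-! ## §3. Crossed homomorphisms `G_{K,S} → 𝐃`, their classes, and Selmer elements -/

section Cocycles

variable {K : Type} [Field K] [NumberField K] {S : Set (HeightOneSpectrum (𝓞 K))} {p : ℕ}
  [Fact p.Prime] {𝒪 : Type} [CommRing 𝒪] [TopologicalSpace 𝒪]
  {A : Type} [AddCommGroup A] [Module 𝒪 A] [TopologicalSpace A] [DiscreteTopology A]
  [TopologicalSpace (PowerSeries 𝒪)] [TopologicalSpace (PowerSeries (PowerSeries 𝒪))]
  [IsTopologicalAddGroup (IndModule₂ 𝒪 p A)]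
  [ContinuousSMul (PowerSeries (PowerSeries 𝒪)) (IndModule₂ 𝒪 p A)]
  (hS : ∀ v : HeightOneSpectrum (𝓞 K), ((p : ℕ) : 𝓞 K) ∈ v.asIdeal → v ∈ S)
  (κ₁ κ₂ : ZpExtension K p) (ρ₀ : ContinuousRep (GaloisGroupUnramifiedOutside K S) 𝒪 A)

/-- **One exponent kills a continuous crossed homomorphism `c : G_{K,S} → 𝐃` under `X` and `C X`**:
`G_{K,S}` is compact and `𝐃` discrete, so `c` has finitely many values, each killed by a power of both
variables (§2). [cite: SerreGaloisCohomology1997, Ch. I §2.2] [cite: GreenbergLNM1716, §1 (after Conj. 1.3)] -/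
theorem exists_pow_smul_contOneCocycles_eq_zero
    (c : contOneCocycles (twistDeformation S hS κ₁ κ₂ ρ₀).toTopRep) :
    ∃ n : ℕ, (PowerSeries.X : PowerSeries (PowerSeries 𝒪)) ^ n • c = 0 ∧
      (PowerSeries.C PowerSeries.X : PowerSeries (PowerSeries 𝒪)) ^ n • c = 0 := by
  have hfin : (Set.range fun g ↦ (c.1 g : IndModule₂ 𝒪 p A)).Finite :=
    (isCompact_range (c.1.continuous : Continuous fun g ↦ (c.1 g : IndModule₂ 𝒪 p A))).finite_of_discrete
  obtain ⟨n₁, hn₁⟩ := exists_uniform_pow_smul_eq_zero (PowerSeries.X : PowerSeries (PowerSeries 𝒪))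
    hfin (fun Φ _ ↦ IndModule₂.exists_X_pow_smul_eq_zero Φ)
  obtain ⟨n₂, hn₂⟩ := exists_uniform_pow_smul_eq_zero
    (PowerSeries.C PowerSeries.X : PowerSeries (PowerSeries 𝒪)) hfin
    (fun Φ _ ↦ IndModule₂.exists_C_X_pow_smul_eq_zero Φ)
  refine ⟨n₁ + n₂, ?_, ?_⟩
  · apply Subtype.ext
    refine ContinuousMap.ext fun g ↦ ?_
    change (PowerSeries.X : PowerSeries (PowerSeries 𝒪)) ^ (n₁ + n₂) • (c.1 g : IndModule₂ 𝒪 p A) = 0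
    exact pow_smul_eq_zero_of_le _ (hn₁ _ ⟨g, rfl⟩) (Nat.le_add_right _ _)
  · apply Subtype.ext
    refine ContinuousMap.ext fun g ↦ ?_
    change (PowerSeries.C PowerSeries.X : PowerSeries (PowerSeries 𝒪)) ^ (n₁ + n₂) •
      (c.1 g : IndModule₂ 𝒪 p A) = 0
    exact pow_smul_eq_zero_of_le _ (hn₂ _ ⟨g, rfl⟩) (Nat.le_add_left _ _)

/-- **Every class `ξ ∈ H¹(K_Σ/K, 𝐃)` is killed by ONE power of `T₁ = X` and of `T₂ = C X`** — the
hypothesis `hnil` of `balanced_of_generators` for `S₁ = H¹(K_Σ/K, 𝐃)` ("`Λ` acts continuously on the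
discrete `H¹`", so every element is killed by a power of the augmentation ideal).
[cite: Greenberg2006, p. 342 L7–8] [cite: GreenbergLNM1716, §1 (after Conj. 1.3)] -/
theorem exists_pow_smul_H1_eq_zero (ξ : (twistDeformation S hS κ₁ κ₂ ρ₀).H 1) :
    ∃ n : ℕ, (PowerSeries.X : PowerSeries (PowerSeries 𝒪)) ^ n • ξ = 0 ∧
      (PowerSeries.C PowerSeries.X : PowerSeries (PowerSeries 𝒪)) ^ n • ξ = 0 := by
  obtain ⟨c, rfl⟩ := oneCocycleClass_surjective _ ξ
  obtain ⟨n, h₁, h₂⟩ := exists_pow_smul_contOneCocycles_eq_zero hS κ₁ κ₂ ρ₀ c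
  refine ⟨n, ?_, ?_⟩
  · have h1 : (PowerSeries.X : PowerSeries (PowerSeries 𝒪)) ^ n •
        (oneCocycleClass (twistDeformation S hS κ₁ κ₂ ρ₀).toTopRep c :
          (twistDeformation S hS κ₁ κ₂ ρ₀).H 1) =
        oneCocycleClass _ ((PowerSeries.X : PowerSeries (PowerSeries 𝒪)) ^ n • c) :=
      (oneCocycleClass_smul _ _ _).symm
    refine h1.trans ?_
    rw [h₁, oneCocycleClass_zero]
    rfl
  · have h1 : (PowerSeries.C PowerSeries.X : PowerSeries (PowerSeries 𝒪)) ^ n •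
        (oneCocycleClass (twistDeformation S hS κ₁ κ₂ ρ₀).toTopRep c :
          (twistDeformation S hS κ₁ κ₂ ρ₀).H 1) =
        oneCocycleClass _ ((PowerSeries.C PowerSeries.X : PowerSeries (PowerSeries 𝒪)) ^ n • c) :=
      (oneCocycleClass_smul _ _ _).symm
    refine h1.trans ?_
    rw [h₂, oneCocycleClass_zero]
    rfl

omit [IsTopologicalAddGroup (IndModule₂ 𝒪 p A)] in
/-- The same for the elements of any Selmer group `L.selmer ≤ H¹(K_Σ/K, 𝐃)` as elements of the
`Λ₂`-SUBMODULE (the shape of `hnil` in `balanced_of_generators` with `S₁ = L.selmer`, e.g.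
`S_{𝓛_v}(K, 𝐃) = (fullAtSpecification S 𝐃 (inr v)).selmer`). [cite: Greenberg2006, p. 342 L7–8] -/
theorem exists_pow_smul_selmer_eq_zero (L : Specification S (twistDeformation S hS κ₁ κ₂ ρ₀))
    (c : L.selmer) :
    ∃ n : ℕ, (PowerSeries.X : PowerSeries (PowerSeries 𝒪)) ^ n • c = 0 ∧
      (PowerSeries.C PowerSeries.X : PowerSeries (PowerSeries 𝒪)) ^ n • c = 0 := by
  obtain ⟨n, h₁, h₂⟩ := exists_pow_smul_H1_eq_zero hS κ₁ κ₂ ρ₀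
    (c : (twistDeformation S hS κ₁ κ₂ ρ₀).H 1)
  exact ⟨n, Subtype.ext (by rw [Submodule.coe_smul, h₁, Submodule.coe_zero]),
    Subtype.ext (by rw [Submodule.coe_smul, h₂, Submodule.coe_zero])⟩

end Cocycles

end Summit.BirchSwinnertonDyer.BirchSwinnertonDyer.Theorems.GreenbergFullAtSelmer

end
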